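import Summits.ABC.StewartYu.PadicW80ParLB
import HarnessLib

/-!
# The `(log p)`-normalised parameter record `PadicW80ParL` — the closed-form sizes and the two budgets

Support file (theorems only; no named facts), cell `abc-stewartyu` (p1, stub S5 of memo-03 §4): twin of p3's
`PadicW80Budgets.lean` on the `ℓ`-normalised record (the closed forms `E(c), PrV, Dmax_k, Mmax_k, DmaxH, MmaxH`
are defined in `PadicW80ParL.lean` with the same formulas). Positivity, logarithms, and the two WP-A4 BUDGETS
`log(Dmax_k·Mmax_k) ≤ 𝔘/4 + 2ᵏ𝔘/16` and `2^{d+1}·log(4·DmaxH²·MmaxH·Hprod³) − log DmaxH ≤ (7/16)·2ᵈ𝔘`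
(`1 ≤ Hprod ≤ exp(∑V + V_θ)`, and `∑V + V_θ ≤ 2⁻⁹⁰𝔘` holds on the normalised record via `ℓ ≤ W⋆`).
Formula-identical to the landed file; everything is [folklore]. Design note HOME/p1/S5-logp-ledger.md.
-/

noncomputable section

open Finset

namespace Summit.ABC.StewartYu

open PadicW80Par (cTp cSp cLp cLp' Ap mRp)

namespace PadicW80ParL

variable {d : ℕ} (P : PadicW80ParL d)

/-! ### Closed forms: positivity -/

/-- `0 < E(c)`. [folklore] -/
theorem Efacp_pos (c : ℝ) : 0 < P.Efacℓ c := Real.exp_pos _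

/-- `1 ≤ E(c)` for `c ≥ 0`. [folklore] -/
theorem one_le_Efacp {c : ℝ} (hc : 0 ≤ c) : 1 ≤ P.Efacℓ c := by
  unfold Efacℓ; exact Real.one_le_exp (by have := P.𝔘_pos; unfold cLp'; positivity)

/-- `0 < DmaxKℓ`. [folklore] -/
theorem DmaxK_pos (k : ℕ) : 0 < P.DmaxKℓ k := by
  unfold DmaxKℓ; have := P.𝔅_pos; have := P.Efacp_pos ((2 ^ (k + 1) : ℕ) : ℝ); positivity

/-- `1 ≤ PrV`. [folklore] -/
theorem one_le_PrVp : 1 ≤ P.PrVℓ := by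
  unfold PrVℓ
  have h1 : 1 ≤ P.𝔅ℓ ^ 5 := one_le_pow₀ P.one_le_𝔅
  have h2 := P.one_le_Efacp (show (0 : ℝ) ≤ 2 by norm_num)
  nlinarith

/-- `0 < MmaxKℓ`. [folklore] -/
theorem MmaxK_pos (k : ℕ) : 0 < P.MmaxKℓ k := by
  unfold MmaxKℓ; have := P.𝔅_pos; have := P.one_le_PrVp; have := P.DmaxK_pos k; positivity

/-- `1 ≤ DmaxH`. [folklore] -/
theorem one_le_DmaxHp : 1 ≤ P.DmaxHℓ := by
  unfold DmaxHℓ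
  exact one_le_mul_of_one_le_of_one_le (one_le_pow₀ P.one_le_𝔅) (P.one_le_Efacp (by norm_num))

/-- `1 ≤ MmaxH`. [folklore] -/
theorem one_le_MmaxHp : 1 ≤ P.MmaxHℓ := by
  unfold MmaxHℓ
  exact one_le_mul_of_one_le_of_one_le (one_le_mul_of_one_le_of_one_le P.one_le_𝔅 P.one_le_PrVp)
    P.one_le_DmaxHp

/-- `log PrV = log 2 + 5·𝔘/64 + 2·𝔘/(2c_L')`. [folklore] -/
theorem log_PrVp : Real.log P.PrVℓ = Real.log 2 + 5 * (P.𝔘ℓ / 64) + 2 * (P.𝔘ℓ / (2 * cLp')) := by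
  unfold PrVℓ Efacℓ 𝔅ℓ
  rw [Real.log_mul (by positivity) (Real.exp_pos _).ne', Real.log_mul (by norm_num) (by positivity),
    Real.log_pow, Real.log_exp, Real.log_exp]; push_cast; ring

/-- `log(Dmax_k · Mmax_k) = log 2 + 10·𝔘/64 + (2 + 2^{k+2})·𝔘/(2c_L')`. [folklore] -/
theorem log_DmaxK_mul_MmaxK (k : ℕ) : Real.log (P.DmaxKℓ k * P.MmaxKℓ k) =
    Real.log 2 + 10 * (P.𝔘ℓ / 64) + (2 + (2 : ℝ) ^ (k + 2)) * (P.𝔘ℓ / (2 * cLp')) := by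
  have h𝔅 := P.𝔅_pos
  have e : P.DmaxKℓ k * P.MmaxKℓ k = 2 * (P.𝔅ℓ ^ 10 * (P.Efacℓ 2 * P.Efacℓ ((2 ^ (k + 1) : ℕ) : ℝ) ^ 2)) := by
    unfold MmaxKℓ PrVℓ DmaxKℓ; ring
  rw [e, Real.log_mul (by norm_num) (by have := P.Efacp_pos 2; have := P.Efacp_pos ((2 ^ (k + 1) : ℕ) : ℝ); positivity),
    Real.log_mul (by positivity) (by have := P.Efacp_pos 2; have := P.Efacp_pos ((2 ^ (k + 1) : ℕ) : ℝ); positivity),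
    Real.log_mul (P.Efacp_pos 2).ne' (by have := P.Efacp_pos ((2 ^ (k + 1) : ℕ) : ℝ); positivity),
    Real.log_pow, Real.log_pow]
  unfold Efacℓ 𝔅ℓ
  rw [Real.log_exp, Real.log_exp, Real.log_exp]; push_cast; ring

/-- `log DmaxH = 2·𝔘/64 + 2·𝔘/(2c_L')`. [folklore] -/
theorem log_DmaxHp : Real.log P.DmaxHℓ = 2 * (P.𝔘ℓ / 64) + 2 * (P.𝔘ℓ / (2 * cLp')) := by
  unfold DmaxHℓ Efacℓ 𝔅ℓ
  rw [Real.log_mul (by positivity) (Real.exp_pos _).ne', Real.log_pow, Real.log_exp, Real.log_exp]; ring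

/-- `log MmaxH = log 2 + 8·𝔘/64 + 4·𝔘/(2c_L')`. [folklore] -/
theorem log_MmaxHp : Real.log P.MmaxHℓ = Real.log 2 + 8 * (P.𝔘ℓ / 64) + 4 * (P.𝔘ℓ / (2 * cLp')) := by
  have h𝔅 := P.𝔅_pos
  have e : P.MmaxHℓ = 2 * (P.𝔅ℓ ^ 8 * (P.Efacℓ 2 * P.Efacℓ 2)) := by unfold MmaxHℓ PrVℓ DmaxHℓ; ring
  rw [e, Real.log_mul (by norm_num) (by have := P.Efacp_pos 2; positivity),
    Real.log_mul (by positivity) (by have := P.Efacp_pos 2; positivity),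
    Real.log_mul (P.Efacp_pos 2).ne' (P.Efacp_pos 2).ne', Real.log_pow]
  unfold Efacℓ 𝔅ℓ
  rw [Real.log_exp, Real.log_exp]; push_cast; ring

/-! ### The two WP-A4 budgets -/

/-- **Budget of the inner steps**: `log(Dmax_k · Mmax_k) ≤ 𝔘/4 + 2ᵏ𝔘/16`. [folklore] -/
theorem logDM_le_budget (k : ℕ) : Real.log (P.DmaxKℓ k * P.MmaxKℓ k) ≤ P.𝔘ℓ / 4 + 2 ^ k * P.𝔘ℓ / 16 := by
  rw [P.log_DmaxK_mul_MmaxK]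
  have hU := P.𝔘_ge'; have hl2 : Real.log 2 ≤ 1 := by linarith [Real.log_two_lt_d9]
  have h2k : (1 : ℝ) ≤ 2 ^ k := one_le_pow₀ (by norm_num)
  have e4 : (2 : ℝ) ^ (k + 2) = 4 * 2 ^ k := by rw [pow_add]; ring
  rw [e4]; unfold cLp'
  nlinarith [show (2 : ℝ) ^ 98 ≥ 2 ^ 20 by norm_num]

/-- **Budget of the half step**: with `∏H(allᵢ) ≤ exp(∑Vall)` (and `∑Vall ≤ 𝔘/2⁹⁰`),
`2^{d+1}·log(4·DmaxH²·MmaxH·Hprod³) − log DmaxH ≤ (7/16)·2ᵈ·𝔘`. [folklore] -/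
theorem bhalf_le_budget {Hprod : ℝ} (hH1 : 1 ≤ Hprod) (hH : Hprod ≤ Real.exp ((∑ j, P.V j) + P.Vθ)) :
    (2 : ℝ) ^ (d + 1) * Real.log (4 * P.DmaxHℓ ^ 2 * P.MmaxHℓ * Hprod ^ 3) - Real.log P.DmaxHℓ ≤
      7 / 16 * (2 ^ d * P.𝔘ℓ) := by
  have hD1 := P.one_le_DmaxHp; have hM1 := P.one_le_MmaxHp
  have hlogD : 0 ≤ Real.log P.DmaxHℓ := Real.log_nonneg hD1
  have hlogH : Real.log Hprod ≤ (∑ j, P.V j) + P.Vθ := by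
    have := Real.log_le_log (by linarith) hH; rwa [Real.log_exp] at this
  have hlogH0 : 0 ≤ Real.log Hprod := Real.log_nonneg hH1
  have hsum := P.sumV_le_𝔘
  have e : Real.log (4 * P.DmaxHℓ ^ 2 * P.MmaxHℓ * Hprod ^ 3) =
      Real.log 4 + 2 * Real.log P.DmaxHℓ + Real.log P.MmaxHℓ + 3 * Real.log Hprod := by
    rw [Real.log_mul (by positivity) (by positivity), Real.log_mul (by positivity) (by positivity),
      Real.log_mul (by norm_num) (by positivity), Real.log_pow, Real.log_pow]; push_cast; ring
  rw [e, P.log_MmaxHp]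
  rw [P.log_DmaxHp] at hlogD ⊢
  have hl2 : Real.log 2 ≤ 1 := by linarith [Real.log_two_lt_d9]
  have hl4 : Real.log 4 ≤ 2 := by
    rw [show (4 : ℝ) = 2 ^ 2 by norm_num, Real.log_pow]; push_cast; linarith
  have hU := P.𝔘_ge'; have h2d : (1 : ℝ) ≤ 2 ^ d := one_le_pow₀ (by norm_num)
  unfold cLp' at hlogD ⊢
  -- the bracket is `≤ 0.19·𝔘`, times `2^{d+1}` gives `0.38·2^d·𝔘 ≤ (7/16)·2^d·𝔘`
  have hbr : Real.log 4 + 2 * (2 * (P.𝔘ℓ / 64) + 2 * (P.𝔘ℓ / (2 * 2 ^ 12))) +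
      (Real.log 2 + 8 * (P.𝔘ℓ / 64) + 4 * (P.𝔘ℓ / (2 * 2 ^ 12))) + 3 * Real.log Hprod ≤ 7 / 32 * P.𝔘ℓ := by
    nlinarith [show (2 : ℝ) ^ 98 ≥ 2 ^ 95 by norm_num]
  have h2d0 : (0 : ℝ) ≤ 2 ^ (d + 1) := by positivity
  calc (2 : ℝ) ^ (d + 1) * (Real.log 4 + 2 * (2 * (P.𝔘ℓ / 64) + 2 * (P.𝔘ℓ / (2 * 2 ^ 12))) +
        (Real.log 2 + 8 * (P.𝔘ℓ / 64) + 4 * (P.𝔘ℓ / (2 * 2 ^ 12))) + 3 * Real.log Hprod) -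
        (2 * (P.𝔘ℓ / 64) + 2 * (P.𝔘ℓ / (2 * 2 ^ 12)))
      ≤ 2 ^ (d + 1) * (7 / 32 * P.𝔘ℓ) - 0 := by
        gcongr
    _ = 7 / 16 * (2 ^ d * P.𝔘ℓ) := by rw [pow_succ]; ring

end PadicW80ParL

end Summit.ABC.StewartYu

end
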